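import Summits.Ventures.PercRepro.RankLevelSetExplicitLin2LevelTail
import Summits.Ventures.PercRepro.S2MultWeightSumsC

/-!
# PercRepro — THE `(Y)`-TAIL FROM ONE KERNEL EVALUATION AT THE TOP CORANK: THE OPTIMAL CHERNOFF PAIR AND THE MONOTONE
TRANSFER (p4, S4 feed)

`proofs/P4-gen18.md` §4. The core of any multiplicity key needs `16·Σ_{j ≤ K} C(n, j) ≤ 2^n` at `K = q + d`, `n = p + d` for every
core corank `d` (RankLevelSetExplicitLin2CoreMultTail); RankLevelSetExplicitLin2LevelTail derives it at every corank from the fixed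
Chernoff pair (`8n ≥ 17K + 216`). Here (i) the partial binomial sum `S(n, K) = Σ_{j ≤ K} C(n, j)` is shown to satisfy
`2·S(n, K) ≤ S(n + 1, K + 1)` and `S(n + 1, K) ≤ 2·S(n, K)` (Pascal), so the tail inequality is MONOTONE: it transfers from the
top corank `d_max` DOWN to every smaller corank at the same rank (`tail_down`) and UP in the rank (`tail_up`); (ii) at the top
corank it follows from ONE kernel inequality with the OPTIMAL Chernoff pair `(a, b) = (n − K, K)`:
`16·n^n ≤ 2^n·(n − K)^{n−K}·K^K` (`tail_of_optimal_chernoff`, through `pow_mul_sum_range_choose_le_add_pow`). The level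
assembly `c025_level_succ_of_key_row_tailOpt` is `c025_level_succ_of_key_row_tail` (RankLevelSetExplicitLin2LevelTail) with the tail from that one evaluation (RE-BASED on
RankLevelSetExplicitLin2LevelTail p431493 per RULING (um)(89): the wrapper uses p9's `regime_two_of_base` and
`c025_core_explicit_large_of'`; the primed copies `regime_two_succ'`, `regime_two_of_base'`, `c025_core_explicit_large_of''` made
while TailChernoff's olean was dropped are RETIRED — kept under the append-only rule, not to be cited):
at `q = 10 … 16` the thresholds move from `1 212 / 2 367 / 4 674 / 9 286 / 18 505 / 36 940 / 73 807` to
`1 165 / 2 236 / 4 349 / 8 536 / 16 856 / 33 419 / 66 440`. Axioms: standard.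
-/

open scoped Matroid

namespace PercRepro

namespace ThmN

namespace Explicit

/-- RETIRED PRIMED COPY (RULING (um)(89)): the theorem of record is p9's `PercRepro.ThmN.Explicit.regime_two_succ`
(RankLevelSetExplicitLin2LevelTail p431493, now IMPORTED and used below); this copy was made while TailChernoff's olean was
dropped by the builder and is kept only under the gate's append-only rule — NOT to be cited. -/
theorem regime_two_succ' (q p : ℕ) (hp : q + 2 ≤ p)
    (h : 2 ^ (p + q) * 2 ^ (2 ^ q - 1 - q) * (2 * (p - 1 - q) + 1) ≤ 4 ^ (p - 1 - q)) :
    2 ^ (p + 1 + q) * 2 ^ (2 ^ q - 1 - q) * (2 * (p + 1 - 1 - q) + 1) ≤ 4 ^ (p + 1 - 1 - q) := by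
  set a := p - 1 - q with ha
  have ha1 : 1 ≤ a := by omega
  rw [show p + 1 - 1 - q = a + 1 by omega, show p + 1 + q = (p + q) + 1 by ring, pow_succ, pow_succ]
  set X := 2 ^ (p + q) * 2 ^ (2 ^ q - 1 - q) with hX
  calc 2 ^ (p + q) * 2 * 2 ^ (2 ^ q - 1 - q) * (2 * (a + 1) + 1) = X * (2 * (2 * (a + 1) + 1)) := by ring
    _ ≤ X * (4 * (2 * a + 1)) := Nat.mul_le_mul_left _ (by omega)
    _ = (X * (2 * a + 1)) * 4 := by ring
    _ ≤ 4 ^ a * 4 := Nat.mul_le_mul_right _ h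

/-- RETIRED PRIMED COPY (RULING (um)(89)): the theorem of record is p9's `PercRepro.ThmN.Explicit.regime_two_of_base`
(RankLevelSetExplicitLin2LevelTail p431493, imported and used below); kept only under the append-only rule — NOT to be cited. -/
theorem regime_two_of_base' (q p₀ : ℕ) (hp₀ : q + 2 ≤ p₀)
    (hbase : 2 ^ (p₀ + q) * 2 ^ (2 ^ q - 1 - q) * (2 * (p₀ - 1 - q) + 1) ≤ 4 ^ (p₀ - 1 - q)) :
    ∀ p, p₀ ≤ p → 2 ^ (p + q) * 2 ^ (2 ^ q - 1 - q) * (2 * (p - 1 - q) + 1) ≤ 4 ^ (p - 1 - q) := by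
  intro p hp
  induction p, hp using Nat.le_induction with
  | base => exact hbase
  | succ p hp ih => exact regime_two_succ' q p (by omega) ih

/-- **PASCAL, SUMMED, UPWARD**: `2·Σ_{j ≤ K} C(n, j) ≤ Σ_{j ≤ K+1} C(n + 1, j)` (the right side is `2·S(n, K) + C(n, K + 1)`). -/
theorem two_mul_sum_range_choose_le_succ_succ (n K : ℕ) :
    2 * ∑ j ∈ Finset.range (K + 1), n.choose j ≤ ∑ j ∈ Finset.range (K + 1 + 1), (n + 1).choose j := by
  have h1 : ∑ j ∈ Finset.range (K + 1 + 1), (n + 1).choose j =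
      ∑ j ∈ Finset.range (K + 1), (n + 1).choose (j + 1) + (n + 1).choose 0 := Finset.sum_range_succ' _ _
  have h2 : ∑ j ∈ Finset.range (K + 1), (n + 1).choose (j + 1) =
      ∑ j ∈ Finset.range (K + 1), n.choose j + ∑ j ∈ Finset.range (K + 1), n.choose (j + 1) := by
    rw [← Finset.sum_add_distrib]
    apply Finset.sum_congr rfl
    intro j _
    exact Nat.choose_succ_succ n j
  have h3 : ∑ j ∈ Finset.range (K + 1), n.choose (j + 1) + n.choose 0 =
      ∑ j ∈ Finset.range (K + 1 + 1), n.choose j := (Finset.sum_range_succ' _ _).symm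
  have h4 : ∑ j ∈ Finset.range (K + 1 + 1), n.choose j =
      ∑ j ∈ Finset.range (K + 1), n.choose j + n.choose (K + 1) := Finset.sum_range_succ _ _
  rw [Nat.choose_zero_right] at h1 h3
  omega

/-- **PASCAL, SUMMED, IN THE RANK**: `Σ_{j ≤ K} C(n + 1, j) ≤ 2·Σ_{j ≤ K} C(n, j)` (the left side is `2·S(n, K) − C(n, K)`). -/
theorem sum_range_choose_succ_le_two_mul (n K : ℕ) :
    ∑ j ∈ Finset.range (K + 1), (n + 1).choose j ≤ 2 * ∑ j ∈ Finset.range (K + 1), n.choose j := by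
  have h1 : ∑ j ∈ Finset.range (K + 1), (n + 1).choose j =
      ∑ j ∈ Finset.range K, (n + 1).choose (j + 1) + (n + 1).choose 0 := Finset.sum_range_succ' _ _
  have h2 : ∑ j ∈ Finset.range K, (n + 1).choose (j + 1) =
      ∑ j ∈ Finset.range K, n.choose j + ∑ j ∈ Finset.range K, n.choose (j + 1) := by
    rw [← Finset.sum_add_distrib]
    apply Finset.sum_congr rfl
    intro j _
    exact Nat.choose_succ_succ n j
  have h3 : ∑ j ∈ Finset.range K, n.choose (j + 1) + n.choose 0 =
      ∑ j ∈ Finset.range (K + 1), n.choose j := (Finset.sum_range_succ' _ _).symm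
  have h4 : ∑ j ∈ Finset.range (K + 1), n.choose j = ∑ j ∈ Finset.range K, n.choose j + n.choose K :=
    Finset.sum_range_succ _ _
  rw [Nat.choose_zero_right] at h1 h3
  omega

/-- One step down the coranks: the tail at `(p, d + 1)` gives the tail at `(p, d)`. -/
theorem tail_down_step (p q d : ℕ)
    (h : 16 * ∑ j ∈ Finset.range (q + (d + 1) + 1), (p + (d + 1)).choose j ≤ 2 ^ (p + (d + 1))) :
    16 * ∑ j ∈ Finset.range (q + d + 1), (p + d).choose j ≤ 2 ^ (p + d) := by
  have hh := two_mul_sum_range_choose_le_succ_succ (p + d) (q + d)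
  rw [show p + (d + 1) = p + d + 1 by omega, show q + (d + 1) + 1 = q + d + 1 + 1 by omega, pow_succ] at h
  omega

/-- **THE TAIL TRANSFERS DOWN THE CORANKS**: `16·S(p + d, q + d) ≤ 2^{p+d}` at every `d ≤ D` once it holds at `d = D`. -/
theorem tail_down (p q D : ℕ)
    (hD : 16 * ∑ j ∈ Finset.range (q + D + 1), (p + D).choose j ≤ 2 ^ (p + D)) :
    ∀ d, d ≤ D → 16 * ∑ j ∈ Finset.range (q + d + 1), (p + d).choose j ≤ 2 ^ (p + d) := by
  intro d hd
  obtain ⟨t, rfl⟩ := Nat.exists_eq_add_of_le hd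
  induction t with
  | zero => simpa using hD
  | succ t ih =>
    refine ih ?_ (by omega)
    apply tail_down_step p q (d + t)
    rw [show d + t + 1 = d + (t + 1) by omega]
    exact hD

/-- **THE TAIL TRANSFERS UP THE RANK**: `16·S(p + d, q + d) ≤ 2^{p+d}` at every `p ≥ p₀` once it holds at `p₀`. -/
theorem tail_up (p₀ q d : ℕ)
    (h0 : 16 * ∑ j ∈ Finset.range (q + d + 1), (p₀ + d).choose j ≤ 2 ^ (p₀ + d)) :
    ∀ p, p₀ ≤ p → 16 * ∑ j ∈ Finset.range (q + d + 1), (p + d).choose j ≤ 2 ^ (p + d) := by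
  intro p hp
  induction p, hp using Nat.le_induction with
  | base => exact h0
  | succ p _ ih =>
    have h := sum_range_choose_succ_le_two_mul (p + d) (q + d)
    rw [show p + d + 1 = p + 1 + d by omega] at h
    have h2 : 2 ^ (p + 1 + d) = 2 * 2 ^ (p + d) := by
      rw [show p + 1 + d = p + d + 1 by omega, pow_succ]; ring
    rw [h2]
    omega

/-- **THE TAIL FROM THE OPTIMAL CHERNOFF PAIR**: `16·Σ_{j ≤ K} C(n, j) ≤ 2^n` as soon as `16·n^n ≤ 2^n·(n − K)^{n−K}·K^K`
and `2K ≤ n` (the pair `(a, b) = (n − K, K)` in `pow_mul_sum_range_choose_le_add_pow`; `n^n/((n−K)^{n−K}K^K) = 2^{nH(K/n)}`). -/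
theorem tail_of_optimal_chernoff (n K : ℕ) (hK : 2 * K ≤ n)
    (h : 16 * n ^ n ≤ 2 ^ n * ((n - K) ^ (n - K) * K ^ K)) :
    16 * ∑ j ∈ Finset.range (K + 1), n.choose j ≤ 2 ^ n := by
  have hch := S2.pow_mul_sum_range_choose_le_add_pow (n - K) K n K (by omega) (by omega)
  rw [show n - K + K = n by omega] at hch
  have hpos : 0 < (n - K) ^ (n - K) * K ^ K := Nat.mul_pos Nat.pow_self_pos Nat.pow_self_pos
  apply Nat.le_of_mul_le_mul_right _ hpos
  calc 16 * (∑ j ∈ Finset.range (K + 1), n.choose j) * ((n - K) ^ (n - K) * K ^ K)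
      = 16 * ((n - K) ^ (n - K) * K ^ K * ∑ j ∈ Finset.range (K + 1), n.choose j) := by ring
    _ ≤ 16 * n ^ n := Nat.mul_le_mul_left _ hch
    _ ≤ 2 ^ n * ((n - K) ^ (n - K) * K ^ K) := h

end Explicit

variable {α : Type}

/-- RETIRED PRIMED COPY (RULING (um)(89)): the theorem of record is p9's `PercRepro.ThmN.c025_core_explicit_large_of'`
(RankLevelSetExplicitLin2LevelTail p431493, imported and used below); kept only under the append-only rule — NOT to be cited. -/
theorem c025_core_explicit_large_of'' (q : ℕ) (hq : 3 ≤ q) (N₁ P₂ : ℕ)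
    (hN₁ : ∀ n, N₁ ≤ n → 8 * (q + 1) * 2 ^ (2 ^ q - 1 - q) * n ^ q ≤ 2 ^ n)
    (hP₂ : ∀ p, P₂ ≤ p → 2 ^ (p + q) * 2 ^ (2 ^ q - 1 - q) * (2 * (p - 1 - q) + 1) ≤ 4 ^ (p - 1 - q))
    (M : Matroid α) [M.Finite] (p : ℕ) (hp : N₁ ≤ p) (hp2 : P₂ ≤ p) (hp3 : 2 ^ q + 2 ≤ p)
    (hR : M.eRank = (p : ℕ∞)) (hbig : p + q + 2 ^ q < M.E.ncard)
    (hfree : ∀ e ∈ M.E, ∃ A ⊆ M.E \ {e}, e ∉ M.closure A ∧ e ∉ M.closure ((M.E \ {e}) \ A)) :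
    RLS M p q := by
  have hq1 := Explicit.succ_le_two_pow q
  refine core_all_corank_of_thresholds_of_bound q (2 ^ q - 1) (by omega) (by omega) N₁ P₂ hN₁ hP₂ M p ?_ hR ?_ hfree ?_
  · exact max_le (max_le hp hp2) hp3
  · omega
  · intro j hj X hX hr
    have hL := not_isLoop_of_free M hfree
    have h1 := ncard_add_one_le_two_pow_of_eRk_le M hL hfree j X hX hr
    have h2 := Explicit.two_pow_add_le_two_pow_add j q hj
    omega

/-- **THE LEVEL FROM ONE EVALUATED ROW OF ANY KEY, WITH THE TAIL FROM ONE KERNEL EVALUATION AT THE TOP CORANK**: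
`c025_level_succ_of_key_row_tail` with the Chernoff tail `8p₀ ≥ 9(q + 1 + 2^{q+1}) + 17(q + 1) + 216` replaced by the optimal
pair at the top core corank `D = q + 1 + 2^{q+1}`: `htop : 16·n₀^{n₀} ≤ 2^{n₀}·(n₀ − K₀)^{n₀−K₀}·K₀^{K₀}` for `n₀ = p₀ + D`,
`K₀ = q + 1 + D` (with `2K₀ ≤ n₀`); the tail at every core corank and every `p ≥ p₀` follows by `tail_up` and `tail_down`. -/
theorem c025_level_succ_of_key_row_tailOpt (q : ℕ) (hq : 7 ≤ q) (p₀ N₁ P₂ : ℕ) (K : ℕ → ℕ → Prop)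
    (hN₁ : N₁ ≤ p₀) (hm : 2 * (q + 1) ≤ N₁)
    (hbase₁ : 8 * (q + 1 + 1) * 2 ^ (2 ^ (q + 1) - 1 - (q + 1)) * N₁ ^ (q + 1) ≤ 2 ^ N₁)
    (hP₂ : P₂ ≤ p₀) (hP₂q : q + 1 + 2 ≤ P₂)
    (hbase₂ : 2 ^ (P₂ + (q + 1)) * 2 ^ (2 ^ (q + 1) - 1 - (q + 1)) * (2 * (P₂ - 1 - (q + 1)) + 1) ≤
      4 ^ (P₂ - 1 - (q + 1)))
    (hp3 : 2 ^ (q + 1) + 2 ≤ p₀)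
    (hK₀ : 2 * (q + 1 + (q + 1 + 2 ^ (q + 1))) ≤ p₀ + (q + 1 + 2 ^ (q + 1)))
    (htop : 16 * (p₀ + (q + 1 + 2 ^ (q + 1))) ^ (p₀ + (q + 1 + 2 ^ (q + 1))) ≤
      2 ^ (p₀ + (q + 1 + 2 ^ (q + 1))) *
        ((p₀ + (q + 1 + 2 ^ (q + 1)) - (q + 1 + (q + 1 + 2 ^ (q + 1)))) ^
            (p₀ + (q + 1 + 2 ^ (q + 1)) - (q + 1 + (q + 1 + 2 ^ (q + 1)))) *
          (q + 1 + (q + 1 + 2 ^ (q + 1))) ^ (q + 1 + (q + 1 + 2 ^ (q + 1)))))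
    (hmono : ∀ p d, q + 1 ≤ d → K p d → K (p + 1) d)
    (hcore : ∀ (M : Matroid α) [M.Finite] (p d : ℕ), q + 2 ≤ d → d ≤ q + 1 + 2 ^ (q + 1) →
      16 * ∑ j ∈ Finset.range (q + 1 + d + 1), (p + d).choose j ≤ 2 ^ (p + d) →
      K p d → M.eRank = (p : ℕ∞) → M.E.ncard = p + d →
      (∀ e ∈ M.E, ∃ A ⊆ M.E \ {e}, e ∉ M.closure A ∧ e ∉ M.closure ((M.E \ {e}) \ A)) → RLS M p (q + 1))
    (hrow : ∀ t < 2 ^ (q + 1), K p₀ (q + 2 + t))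
    (hprev : ∀ (M : Matroid α) [M.Finite] (p : ℕ), p₀ - 1 ≤ p → RLS M p q) :
    ∀ (M : Matroid α) [M.Finite] (p : ℕ), p₀ ≤ p → RLS M p (q + 1) := by
  intro M _ p hp
  have h2q : 2 ≤ 2 ^ (q + 1 + 1) := by
    calc 2 = 2 ^ 1 := by norm_num
      _ ≤ 2 ^ (q + 1 + 1) := Nat.pow_le_pow_right (by norm_num) (by omega)
  -- the tail at the top corank from the optimal pair, then at every `p ≥ p₀` and every smaller corank
  have htail0 := Explicit.tail_of_optimal_chernoff (p₀ + (q + 1 + 2 ^ (q + 1))) (q + 1 + (q + 1 + 2 ^ (q + 1))) hK₀ htop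
  have htailp := Explicit.tail_up p₀ (q + 1) (q + 1 + 2 ^ (q + 1)) htail0 p hp
  have htaild := Explicit.tail_down p (q + 1) (q + 1 + 2 ^ (q + 1)) htailp
  refine rls_succ_large_at (α := α) q (q + 1) p (by omega) (fun M' _ => hprev M' (p - 1) (by omega)) ?_ ?_ M
  · intro M' _ hn
    rcases Nat.lt_or_ge M'.E.ncard (p + (q + 1)) with h | h
    · exact RLS_of_ncard_lt M' h
    · exact RLS_of_ncard_eq M' (by omega)
  · intro M' _ hR hbig hfree
    rcases Nat.lt_or_ge M'.E.ncard (p + (q + 1) + 2 ^ (q + 1) + 1) with h | h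
    · have hkey0 := hrow (M'.E.ncard - p - (q + 2)) (by omega)
      rw [show q + 2 + (M'.E.ncard - p - (q + 2)) = M'.E.ncard - p by omega] at hkey0
      have hkey := key_mono_of_succ K (M'.E.ncard - p) (fun p' => hmono p' (M'.E.ncard - p) (by omega)) p₀ p hp hkey0
      have hT := htaild (M'.E.ncard - p) (by omega)
      exact hcore M' p (M'.E.ncard - p) (by omega) (by omega) hT hkey hR (by omega) hfree
    · exact c025_core_explicit_large_of' (q + 1) (by omega) N₁ P₂ (Explicit.regime_one_of_base (q + 1) N₁ hm hbase₁)
        (Explicit.regime_two_of_base (q + 1) P₂ hP₂q hbase₂) M' p (hN₁.trans hp) (hP₂.trans hp) (hp3.trans hp) hR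
        (by omega) hfree

end ThmN

end PercRepro
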